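import Summits.HodgeConjecture.HodgeConjecture.Theorems.Ring2AbelianAllWeilSign
import Literature.AlgebraicGeometry.VanGeemen1994.WeilDiscriminantOfHyperbolic
import Literature.NumberTheory.QuadraticForms.HilbertSymbolPlaces
import Literature.NumberTheory.QuadraticForms.HilbertReciprocityRat
import Literature.NumberTheory.QuadraticForms.NormIndexFromReciprocityProofs
import Literature.NumberTheory.QuadraticForms.HasseNormTheoremHolds
import HarnessLib

/-!
# Ring 2 — Weil-family coverage, QUADRATIC rows: van Geemen's discriminant group `ℚ^×/Nm(K_d^×)` IS the group
  of Hilbert-symbol patterns of `( · , -d)` — the row index `a` of `W_{2n}.d.a` as a `T`-set, with Serre's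
  explicit local signs (the quadratic twin of `Ring2WeilCoverageCMFieldNormResidueSymbols`)

research route conditional on HC_CM; not a corollary; Q11.4-sentence-2 already refuted in dim ≥ 3.

The rows `W_{2n}.d.a` of the census sections «## b01», «## b02», «## b04», «## b05» (quadratic `K_d = ℚ(√-d)`,
van Geemen LNM 1594, 4.14 / Lemma 5.2) are indexed by `a ∈ weilNormResidueGroup d = ℚˣ ⧸ Nm(K_dˣ)`
[cite: vanGeemen1994HodgeAV, 4.14 and Lemma 5.2] and labelled there by the finite even sets `T(a)` of primes
(and `∞`) at which `(a, -d)_p = -1`, computed with Legendre symbols.  As for the CM-field rows (ring2-b03 gen 62,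
`Ring2WeilCoverageCMFieldNormResidueSymbols*`), ONE bridge puts this group inside the tree's fully proved
O'Meara/Serre library over `ℚ` (`Literature/NumberTheory/QuadraticForms`):

* §1 `weilField_normUnitsSubgroup_eq_quadraticNormSubgroup`: `Nm(K_dˣ) = quadraticNormSubgroup ℚ (-d)` (`0 < d`).
* §2 `weil_mk_eq_mk_iff_hilbertSymbol_eq_one` (63:10); §3 `weil_mk_eq_mk_iff_badPlaces_eq` (Hasse 65:23 over `ℚ`,
  `Automorphic.hilbertSymbol_eq_one_of_forall_completions_holds ℚ`): **`[a] = [a'] ⟺ T(a) = T(a')`**;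
  the real place: `∞ ∈ T(t) ⟺ t < 0`; for `a, a' > 0`: `[a] = [a']` iff the finite bad places agree.
* §4 `weil_even_ncard_badPlaces` (`hilbertReciprocity_rat`): `|T(a)|` even; `weil_exists_pos_badPlaces_eq`
  (`exists_hilbertSymbol_eq_neg_one_iff_rat`, O'Meara 71:19 over `ℚ`): every finite even set of primes at which
  `-d` is a local non-square is `T(a)` for some `a > 0`.
* §5 EXPLICIT: `weil_inl_mem_badPlaces_intCast_iff` — for an integer `A ≠ 0` and a finite place `v` over `p`,
  `v ∈ T(A) ⟺ localSign p A (-d) = -1` with Serre's closed formula (`hilbertSymbol_rat_eq_localSign`: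
  `(p^α u, p^β w)_p = (-1)^{αβε(p)} (u/p)^β (w/p)^α` for odd `p`, the `ε/ω` rule at `2`) [cite: Serre1973, Ch. III
  §1.2 Thm. 1]; hence `weil_mk_intCast_eq_mk_intCast_iff`: for integers `A, A' ≠ 0`,
  **`[A] = [A'] ⟺ (0 < A ↔ 0 < A') ∧ ∀ p` prime, `localSign p A (-d) = localSign p A' (-d)`** — a DECIDABLE
  closed form of every quadratic row label (only the primes `p ∣ 2dAA'` matter, `localSign_eq_one_of_not_dvd`).
No new definition, no named fact, no sorry.
-/

noncomputable section

set_option linter.dupNamespace false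

open Polynomial NumberField IsDedekindDomain

namespace Summit.HodgeConjecture.HodgeConjecture.Ring2.WeilCoverage

open Literature.AlgebraicGeometry.Motives (normUnitsSubgroup mem_normUnitsSubgroup_iff)
open Literature.AlgebraicGeometry.VanGeemen1994
open Literature.NumberTheory.QuadraticForms
open Summit.HodgeConjecture.HodgeConjecture.Ring2.AbelianAll (norm_weilField_mk exists_eq_mk_linear)

variable {d : ℕ}

/-! ### §1 The norm subgroup of `K_d = ℚ(√-d)` -/

/-- **`Nm(K_dˣ) = {x² + d y² ≠ 0} = quadraticNormSubgroup ℚ (-d)`** (`0 < d`; every `k ∈ K_d` is `a + b√-d` with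
`Nm k = a² + d b²`). [cite: vanGeemen1994HodgeAV, 4.14] [cite: Omeara1963, §65A (local norms)] -/
theorem weilField_normUnitsSubgroup_eq_quadraticNormSubgroup (hd : 0 < d) :
    normUnitsSubgroup ℚ (weilField d) = quadraticNormSubgroup ℚ (-(d : ℚ)) := by
  haveI : Fact (Irreducible (X ^ 2 + C (d : ℚ) : ℚ[X])) := ⟨irreducible_X_sq_add_C hd⟩
  ext t
  rw [mem_normUnitsSubgroup_iff, mem_quadraticNormSubgroup_iff]
  constructor
  · rintro ⟨k, hk⟩
    obtain ⟨a, b, hab⟩ := exists_eq_mk_linear d (k : weilField d)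
    exact ⟨a, b, by rw [← hk, hab, norm_weilField_mk]; ring⟩
  · rintro ⟨x, y, hxy⟩
    have hz : AdjoinRoot.mk (X ^ 2 + C (d : ℚ)) (C y * X + C x) ≠ 0 := by
      intro h0
      have h1 := norm_weilField_mk d x y
      rw [h0, Algebra.norm_zero] at h1
      exact t.ne_zero (by rw [← hxy]; linear_combination -h1)
    exact ⟨Units.mk0 _ hz, by rw [Units.val_mk0, norm_weilField_mk, ← hxy]; ring⟩

/-- `-d` is not a square in `ℚ` for `0 < d`. [folklore] -/
theorem neg_natCast_not_isSquare (hd : 0 < d) : ¬ IsSquare (-(d : ℚ)) := by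
  rintro ⟨c, hc⟩
  have h1 : (0 : ℚ) ≤ c * c := mul_self_nonneg c
  have h2 : (0 : ℚ) < d := by exact_mod_cast hd
  linarith

/-! ### §2 Classes and the global symbol `( · , -d)_ℚ` (O'Meara 63:10) -/

/-- **`[a] = [a']` in `ℚˣ/Nm(K_dˣ)` iff `(a⁻¹a', -d)_ℚ = 1`.** [cite: Omeara1963, §63B 63:10] [cite: vanGeemen1994HodgeAV, 4.14] -/
theorem weil_mk_eq_mk_iff_hilbertSymbol_eq_one (hd : 0 < d) (a a' : ℚˣ) :
    (QuotientGroup.mk a : weilNormResidueGroup d) = QuotientGroup.mk a' ↔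
      hilbertSymbol ℚ ((a⁻¹ * a' : ℚˣ) : ℚ) (-(d : ℚ)) = 1 := by
  haveI : NeZero (2 : ℚ) := ⟨two_ne_zero⟩
  have hd0 : (-(d : ℚ)) ≠ 0 := by
    have : (0 : ℚ) < d := by exact_mod_cast hd
    linarith
  rw [QuotientGroup.eq, weilField_normUnitsSubgroup_eq_quadraticNormSubgroup hd,
    hilbertSymbol_eq_one_iff_mem_quadraticNormSubgroup hd0]

/-! ### §3 Local–global over `ℚ` (Hasse 65:23) and the `T`-sets -/

/-- **`(t, -d)_ℚ = 1` iff `badPlaces t (-d) = ∅`** (every local symbol, finite and real, is `1`; Hasse's norm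
theorem over `ℚ` and its trivial converse). [cite: Omeara1963, §65D Thm. 65:23] -/
theorem weil_hilbertSymbol_eq_one_iff_badPlaces_eq_empty (hd : 0 < d) {t : ℚ} (ht : t ≠ 0) :
    hilbertSymbol ℚ t (-(d : ℚ)) = 1 ↔ badPlaces t (-(d : ℚ)) = ∅ := by
  rw [Set.eq_empty_iff_forall_notMem]
  constructor
  · intro h p hp
    rw [mem_badPlaces_iff] at hp
    cases p with
    | inl v =>
      rw [placeSymbol_inl, Literature.NumberTheory.Automorphic.hilbertSymbol_map_eq_one _ h] at hp
      norm_num at hp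
    | inr w =>
      rw [placeSymbol_inr, Literature.NumberTheory.Automorphic.hilbertSymbol_map_eq_one _ h] at hp
      norm_num at hp
  · intro h
    rw [hilbertSymbol_comm]
    refine Literature.NumberTheory.Automorphic.hilbertSymbol_eq_one_of_forall_completions_holds ℚ
      (-(d : ℚ)) t (neg_natCast_not_isSquare hd) ht (fun v ↦ ?_) (fun w ↦ ?_)
    · have hv := h (Sum.inl v)
      rw [mem_badPlaces_iff, ← placeSymbol_ne_one_iff, not_not, placeSymbol_inl] at hv
      rw [hilbertSymbol_comm]; exact hv
    · have hw := h (Sum.inr w)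
      rw [mem_badPlaces_iff, ← placeSymbol_ne_one_iff, not_not, placeSymbol_inr] at hw
      rw [hilbertSymbol_comm]; exact hw

/-- `T(a⁻¹) = T(a)` (local symbols multiplicative with values `±1`). [cite: Omeara1963, §63B] -/
theorem weil_badPlaces_inv (hd : 0 < d) (a : ℚˣ) :
    badPlaces ((a⁻¹ : ℚˣ) : ℚ) (-(d : ℚ)) = badPlaces (a : ℚ) (-(d : ℚ)) := by
  have hd0 : (-(d : ℚ)) ≠ 0 := by
    have : (0 : ℚ) < d := by exact_mod_cast hd
    linarith
  ext p
  rw [mem_badPlaces_iff, mem_badPlaces_iff]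
  have hmul := placeSymbol_mul_left (x := ((a⁻¹ : ℚˣ) : ℚ)) (y := (a : ℚ)) (b := -(d : ℚ))
    (Units.ne_zero _) (Units.ne_zero _) hd0 p
  have h1 : placeSymbol (1 : ℚ) (-(d : ℚ)) p = 1 := by
    cases p with
    | inl v => rw [placeSymbol_inl, map_one, hilbertSymbol_one_left]
    | inr w => rw [placeSymbol_inr, map_one, hilbertSymbol_one_left]
  rw [Units.inv_mul, h1] at hmul
  have key : ∀ x y : ℤ, (x = 1 ∨ x = -1) → (y = 1 ∨ y = -1) → 1 = x * y → (x = -1 ↔ y = -1) := by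
    rintro x y (rfl | rfl) (rfl | rfl) h <;> omega
  exact key _ _ (placeSymbol_eq_one_or_eq_neg_one _ _ p) (placeSymbol_eq_one_or_eq_neg_one _ _ p) hmul

/-- **THE QUADRATIC ROW INDEX IS THE `T`-SET: `[a] = [a'] ⟺ badPlaces a (-d) = badPlaces a' (-d)`** (places of
`ℚ`, the real one included). [cite: vanGeemen1994HodgeAV, 4.14 and Lemma 5.2] [cite: Omeara1963, §65D Thm. 65:23] -/
theorem weil_mk_eq_mk_iff_badPlaces_eq (hd : 0 < d) (a a' : ℚˣ) :
    (QuotientGroup.mk a : weilNormResidueGroup d) = QuotientGroup.mk a' ↔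
      badPlaces (a : ℚ) (-(d : ℚ)) = badPlaces (a' : ℚ) (-(d : ℚ)) := by
  have hd0 : (-(d : ℚ)) ≠ 0 := by
    have : (0 : ℚ) < d := by exact_mod_cast hd
    linarith
  rw [weil_mk_eq_mk_iff_hilbertSymbol_eq_one hd, weil_hilbertSymbol_eq_one_iff_badPlaces_eq_empty hd
    (Units.ne_zero _), Units.val_mul, badPlaces_mul (Units.ne_zero _) (Units.ne_zero _) hd0,
    weil_badPlaces_inv hd, Set.symmDiff_eq_empty]

/-- **The real place: `∞ ∈ T(t) ⟺ t < 0`** (`-d < 0`, so `(t, -d)_∞ = -1` iff `t ≤ 0`).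
[cite: Omeara1963, §63B (the symbol over `ℝ`)] [cite: vanGeemen1994HodgeAV, Lemma 5.2 (3)] -/
theorem weil_inr_mem_badPlaces_iff (hd : 0 < d) {t : ℚ} (ht : t ≠ 0) (w : InfinitePlace ℚ) :
    Sum.inr w ∈ badPlaces t (-(d : ℚ)) ↔ t < 0 := by
  have hw : w.IsReal := IsTotallyReal.isReal w
  rw [mem_badPlaces_iff, placeSymbol_inr, hilbertSymbol_completion_eq_neg_one_iff_of_isReal hw,
    eq_ratCast, eq_ratCast, Rat.cast_neg, Rat.cast_natCast]
  have hdR : (0 : ℝ) < d := by exact_mod_cast hd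
  constructor
  · rintro ⟨h1, -⟩
    have h2 : (t : ℝ) ≠ 0 := by exact_mod_cast ht
    exact_mod_cast lt_of_le_of_ne h1 h2
  · intro h
    exact ⟨by exact_mod_cast h.le, by linarith⟩

/-- **For positive `a, a'`: `[a] = [a']` iff their FINITE bad places agree.**
[cite: vanGeemen1994HodgeAV, 4.14 and Lemma 5.2] [cite: Omeara1963, §65D Thm. 65:23] -/
theorem weil_mk_eq_mk_iff_finite_badPlaces_eq (hd : 0 < d) {a a' : ℚˣ} (ha : 0 < (a : ℚ))
    (ha' : 0 < (a' : ℚ)) :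
    (QuotientGroup.mk a : weilNormResidueGroup d) = QuotientGroup.mk a' ↔
      {v : HeightOneSpectrum (𝓞 ℚ) | hilbertSymbol (v.adicCompletion ℚ) (algebraMap ℚ _ (a : ℚ))
          (algebraMap ℚ _ (-(d : ℚ))) = -1} =
        {v : HeightOneSpectrum (𝓞 ℚ) | hilbertSymbol (v.adicCompletion ℚ) (algebraMap ℚ _ (a' : ℚ))
          (algebraMap ℚ _ (-(d : ℚ))) = -1} := by
  rw [weil_mk_eq_mk_iff_badPlaces_eq hd, ← preimage_inl_badPlaces, ← preimage_inl_badPlaces]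
  have hsub : ∀ {b : ℚˣ}, 0 < (b : ℚ) → badPlaces (b : ℚ) (-(d : ℚ)) ⊆ Set.range Sum.inl := by
    rintro b hb (v | w) hp
    · exact ⟨v, rfl⟩
    · rw [weil_inr_mem_badPlaces_iff hd (Units.ne_zero _)] at hp
      exact absurd hp (not_lt.2 hb.le)
  constructor
  · intro h; rw [h]
  · intro h
    rw [← Set.image_preimage_eq_of_subset (hsub ha), ← Set.image_preimage_eq_of_subset (hsub ha'), h]

/-! ### §4 Parity (Hilbert reciprocity over `ℚ`) and realisation (O'Meara 71:19 over `ℚ`) -/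

/-- **`|T(a)|` is even** (`hilbertReciprocity_rat`). [cite: Serre1973, Ch. III §2.1 Thm. 3] [cite: Omeara1963, §71D Thm. 71:18] -/
theorem weil_even_ncard_badPlaces (hd : 0 < d) (a : ℚˣ) :
    (badPlaces (a : ℚ) (-(d : ℚ))).Finite ∧ Even (badPlaces (a : ℚ) (-(d : ℚ))).ncard := by
  have hd0 : (-(d : ℚ)) ≠ 0 := by
    have : (0 : ℚ) < d := by exact_mod_cast hd
    linarith
  refine ⟨badPlaces_finite (Units.ne_zero _) hd0, ?_⟩
  rw [ncard_badPlaces (Units.ne_zero _) hd0]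
  exact (hilbertReciprocity_rat (a : ℚ) (-(d : ℚ)) (Units.ne_zero _) hd0).2

/-- **REALISATION over `ℚ`**: every finite EVEN set `S` of finite places of `ℚ` at which `-d` is a local non-square is
the finite `T`-set of some POSITIVE `a` (O'Meara 71:19 over `ℚ`, `exists_hilbertSymbol_eq_neg_one_iff_rat`).
[cite: Omeara1963, §71 Thm. 71:19 and Cor. 71:19a] -/
theorem weil_exists_pos_badPlaces_eq (hd : 0 < d) (S : Finset (HeightOneSpectrum (𝓞 ℚ))) (hS : Even S.card)
    (hns : ∀ v ∈ S, ¬ IsSquare (algebraMap ℚ (v.adicCompletion ℚ) (-(d : ℚ)))) :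
    ∃ a : ℚˣ, 0 < (a : ℚ) ∧
      {v : HeightOneSpectrum (𝓞 ℚ) | hilbertSymbol (v.adicCompletion ℚ) (algebraMap ℚ _ (a : ℚ))
          (algebraMap ℚ _ (-(d : ℚ))) = -1} = ↑S := by
  classical
  obtain ⟨t, ht0, hfin, hinf⟩ := exists_hilbertSymbol_eq_neg_one_iff_rat (-(d : ℚ)) S ∅ (by simp)
    (by simpa using hS) hns (by simp)
  refine ⟨Units.mk0 t ht0, ?_, ?_⟩
  · rw [Units.val_mk0]
    by_contra hle
    have hlt : t < 0 := lt_of_le_of_ne (not_lt.1 hle) ht0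
    obtain ⟨w⟩ := (inferInstance : Nonempty (InfinitePlace ℚ))
    have hw := (weil_inr_mem_badPlaces_iff hd ht0 w).2 hlt
    rw [mem_badPlaces_iff, placeSymbol_inr, hinf w] at hw
    simp at hw
  · ext v
    rw [Set.mem_setOf_eq, Units.val_mk0, hfin v, Finset.mem_coe]

/-! ### §5 The explicit local signs (Serre III Thm. 1) -/

/-- **`v ∈ T(A) ⟺ localSign p A (-d) = -1`** for an integer `A ≠ 0` and a finite place `v` of `ℚ` over `p`: the
membership of a prime in the `T`-set of an integer row is Serre's explicit sign. [cite: Serre1973, Ch. III §1.2 Thm. 1] -/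
theorem weil_inl_mem_badPlaces_intCast_iff (hd : 0 < d) {A : ℤ} (hA : A ≠ 0) (v : HeightOneSpectrum (𝓞 ℚ)) :
    Sum.inl v ∈ badPlaces (A : ℚ) (-(d : ℚ)) ↔
      localSign (Rat.HeightOneSpectrum.natGenerator v) A (-(d : ℤ)) = -1 := by
  have hdZ : (-(d : ℤ)) ≠ 0 := by
    have : (0 : ℤ) < d := by exact_mod_cast hd
    linarith
  rw [mem_badPlaces_iff, placeSymbol_inl, show (-(d : ℚ)) = ((-(d : ℤ) : ℤ) : ℚ) by push_cast; ring,
    hilbertSymbol_rat_eq_localSign v hA hdZ]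

/-- Serre's local sign of two non-zero integers is `1` or `-1` (it is a Hilbert symbol). [cite: Serre1973, Ch. III §1.2 Thm. 1] -/
theorem localSign_natGenerator_eq_one_or (hd : 0 < d) {A : ℤ} (hA : A ≠ 0) (v : HeightOneSpectrum (𝓞 ℚ)) :
    localSign (Rat.HeightOneSpectrum.natGenerator v) A (-(d : ℤ)) = 1 ∨
      localSign (Rat.HeightOneSpectrum.natGenerator v) A (-(d : ℤ)) = -1 := by
  have hdZ : (-(d : ℤ)) ≠ 0 := by
    have : (0 : ℤ) < d := by exact_mod_cast hd
    linarith
  rw [← hilbertSymbol_rat_eq_localSign v hA hdZ]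
  exact hilbertSymbol_eq_one_or_eq_neg_one _ _

/-- **DECIDABLE CLOSED FORM of the quadratic row labels**: for integers `A, A' ≠ 0`, `[A] = [A']` in `ℚˣ/Nm(K_dˣ)`
iff `A, A'` have the same sign and `localSign p A (-d) = localSign p A' (-d)` for every prime `p` (only `p ∣ 2dAA'`
matter: `localSign_eq_one_of_not_dvd`). [cite: vanGeemen1994HodgeAV, 4.14 and Lemma 5.2] [cite: Serre1973, Ch. III
§1.2 Thm. 1 and §2.1 Thm. 3] -/
theorem weil_mk_intCast_eq_mk_intCast_iff (hd : 0 < d) {A A' : ℤ} (hA : A ≠ 0) (hA' : A' ≠ 0) (a a' : ℚˣ)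
    (ha : (a : ℚ) = A) (ha' : (a' : ℚ) = A') :
    (QuotientGroup.mk a : weilNormResidueGroup d) = QuotientGroup.mk a' ↔
      ((0 < A ↔ 0 < A') ∧ ∀ p : ℕ, p.Prime → localSign p A (-(d : ℤ)) = localSign p A' (-(d : ℤ))) := by
  have hAQ : (A : ℚ) ≠ 0 := by exact_mod_cast hA
  have hAQ' : (A' : ℚ) ≠ 0 := by exact_mod_cast hA'
  have key : ∀ x y : ℤ, (x = 1 ∨ x = -1) → (y = 1 ∨ y = -1) → ((x = -1 ↔ y = -1) ↔ x = y) := by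
    rintro x y (rfl | rfl) (rfl | rfl) <;> decide
  have hsignQ : ((A : ℚ) < 0 ↔ (A' : ℚ) < 0) ↔ (0 < A ↔ 0 < A') := by
    have e1 : ((A : ℚ) < 0 ↔ A < 0) := by exact_mod_cast Iff.rfl
    have e2 : ((A' : ℚ) < 0 ↔ A' < 0) := by exact_mod_cast Iff.rfl
    rw [e1, e2]
    omega
  rw [weil_mk_eq_mk_iff_badPlaces_eq hd, Set.ext_iff, Sum.forall, ha, ha']
  simp only [weil_inl_mem_badPlaces_intCast_iff hd hA, weil_inl_mem_badPlaces_intCast_iff hd hA',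
    weil_inr_mem_badPlaces_iff hd hAQ, weil_inr_mem_badPlaces_iff hd hAQ']
  constructor
  · rintro ⟨hfin, hinf⟩
    obtain ⟨w⟩ := (inferInstance : Nonempty (InfinitePlace ℚ))
    refine ⟨hsignQ.1 (hinf w), fun p hp ↦ ?_⟩
    have hvp : Rat.HeightOneSpectrum.natGenerator
        ((Rat.HeightOneSpectrum.primesEquiv (R := 𝓞 ℚ)).symm ⟨p, hp⟩) = p :=
      congrArg Subtype.val ((Rat.HeightOneSpectrum.primesEquiv (R := 𝓞 ℚ)).apply_symm_apply ⟨p, hp⟩)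
    have h1 := hfin ((Rat.HeightOneSpectrum.primesEquiv (R := 𝓞 ℚ)).symm ⟨p, hp⟩)
    have h2 := localSign_natGenerator_eq_one_or hd hA ((Rat.HeightOneSpectrum.primesEquiv (R := 𝓞 ℚ)).symm ⟨p, hp⟩)
    have h3 := localSign_natGenerator_eq_one_or hd hA' ((Rat.HeightOneSpectrum.primesEquiv (R := 𝓞 ℚ)).symm ⟨p, hp⟩)
    rw [hvp] at h1 h2 h3
    exact (key _ _ h2 h3).1 h1
  · rintro ⟨hsign, hloc⟩
    refine ⟨fun v ↦ ?_, fun w ↦ hsignQ.2 hsign⟩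
    rw [hloc _ (Rat.HeightOneSpectrum.prime_natGenerator v)]

end Summit.HodgeConjecture.HodgeConjecture.Ring2.WeilCoverage

end
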